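import Literature.NumberTheory.Automorphic.HermitianLatticeTreeFrames   -- ★ (T1-C) Gram matrices and frames
import HarnessLib

/-!
# The tree of self-dual and `ϖ`-modular lattices — THE ROOTED STRUCTURE: duality facts (D1)–(D4) and the PARENT of a special lattice in a frame
# (its neighbour towards the root `L₀ = 𝒪²`, of the other type, one level up) (Serre, *Trees*, II.1.1; Bruhat–Tits 1972 §10)

Topic `NumberTheory/Automorphic`; namespace `Literature.NumberTheory.Automorphic.HermitianLatticeTree`.  THEOREMS ONLY (no definition, no instance, no notation, no named
fact, no `sorry`).  Part (T1-D) of the lattice-tree road.  Cell `pub/hodgecm-mathlib` (D-0151), crux H413 (stmt-HodgeConjecture-24833), line «N6nsGerm», the Euler–Poincaré road (R2) `stub_N6nsR2EP : RankOneEulerPoincareNonsplit` — a count-free proof of the ELLIPTIC relation (E) of ★ `Rogawski1990/RankOneEulerPoincareGlue` at every TAME non-split place, inert and ramified alike (A-p17 (g22) bytes (T1), co-hand A-p06 (g27) `F0/P3a/A-p06/g27/CENSUS-R2ram-RamifiedEulerPoincare.A-p06g27.md`, LEAD F0P3a-plan (g10) WORDS T9-6 ∕ T9-8).  HONEST LABEL: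 HC_CM is proved only modulo the printed citations until rung 0 closes; nothing printed is asserted here (elementary lattice algebra over a valuation ring).

* `scaleLattice_zpow_latt_one`, `scaleLattice_uniformizer_latt_mul_diagonal`, `scaleLattice_inv_uniformizer_latt_mul_diagonal`, `latt_le_latt_iff`,
  (D1) **`eq_of_le_of_isSelfDualLattice`**, (D2) **`eq_of_le_of_isModularLattice`** (comparable lattices of one type are equal), `latticeDepth_frame_cast`,
  (D3) **`le_scaleLattice_of_isSelfDualLattice`** (`ϖ^k L₀ ≤ M` ⇒ `M ≤ ϖ^{−k} L₀`), (D4) **`le_scaleLattice_of_isModularLattice`** (⇒ `N ≤ ϖ^{1−k} L₀`).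
* **`latticeParent_of_isSelfDualLattice`** ∕ **`latticeParent_of_isModularLattice`**: in a frame the parent of `diag(ϖ^a, ϖ^b)` (`k = max(a,b) ≥ 1`) is
  `diag(ϖ^{max(a,1−k)}, ϖ^{max(b,1−k)})` ∕ `diag(ϖ^{max(a−1,1−k)}, ϖ^{max(b−1,1−k)})`; it has the OTHER type, is ADJACENT (`ϖL ≤ Λ ≤ L`) and its depth is `k` ∕ `k − 1`.

## References
* [Serre1980Trees] J.-P. Serre, *Trees* (1980), Ch. II §1.1 (the tree of `SL₂` over a local field: lattices, adjacency, distance from a base lattice).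
* [Jacobowitz1962] R. Jacobowitz, *Hermitian forms over local fields*, Amer. J. Math. 84 (1962), §4, §7–§8 (unimodular and `𝔭`-modular hermitian lattices).
* [BruhatTits1972] F. Bruhat, J. Tits, *Groupes réductifs sur un corps local I*, Publ. IHÉS 41 (1972), §10 (the building of a rank-one group is a tree).
* [Kottwitz1988] R. E. Kottwitz, *Tamagawa numbers*, Ann. of Math. 127 (1988), §2 (facets of the building and the Euler–Poincaré function).
-/

set_option autoImplicit false

noncomputable section

open scoped ValuativeRel Matrix MatrixGroups
open Matrix ValuativeRel

namespace Literature.NumberTheory.Automorphic.HermitianLatticeTree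

variable {E : Type*} [Field E] [ValuativeRel E]

/-! ## §8 The rooted structure: parents of special lattices, the KEY lemma, the tree -/

section Rooted

variable (σ : E →+* E) (hσv : ∀ x : E, valuation E (σ x) = valuation E x) {ϖ : E} (hϖ : IsUniformizingElement ϖ)
  {H : Matrix (Fin 2) (Fin 2) E} (hH : IsUnimodular₂ H)

include hϖ in
/-- `ϖ^c · L₀ = latt (P·diag(ϖ^c, ϖ^c))` in any integral frame. [cite: Serre1980Trees, II.1.1] -/
theorem scaleLattice_zpow_latt_one (P : GL (Fin 2) E) (hP : P ∈ glInt 2 E) (c : ℤ) :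
    scaleLattice (ϖ ^ c) (latt (1 : Matrix (Fin 2) (Fin 2) E)) = latt ((P : Matrix (Fin 2) (Fin 2) E) * Matrix.diagonal ![ϖ ^ c, ϖ ^ c]) := by
  rw [latt_one_eq_latt_mul_diagonal_zero P hP, scaleLattice_zpow_latt_mul_diagonal hϖ, zero_add]

include hϖ in
/-- `ϖ · latt (P·diag(ϖ^a, ϖ^b)) = latt (P·diag(ϖ^{a+1}, ϖ^{b+1}))`. [cite: Serre1980Trees, II.1.1] -/
theorem scaleLattice_uniformizer_latt_mul_diagonal (P : GL (Fin 2) E) (a b : ℤ) :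
    scaleLattice ϖ (latt ((P : Matrix (Fin 2) (Fin 2) E) * Matrix.diagonal ![ϖ ^ a, ϖ ^ b])) =
      latt ((P : Matrix (Fin 2) (Fin 2) E) * Matrix.diagonal ![ϖ ^ (a + 1), ϖ ^ (b + 1)]) := by
  have h := scaleLattice_zpow_latt_mul_diagonal hϖ P a b 1
  rwa [zpow_one] at h

include hϖ in
/-- `ϖ⁻¹ · latt (P·diag(ϖ^a, ϖ^b)) = latt (P·diag(ϖ^{a−1}, ϖ^{b−1}))`. [cite: Serre1980Trees, II.1.1] -/
theorem scaleLattice_inv_uniformizer_latt_mul_diagonal (P : GL (Fin 2) E) (a b : ℤ) :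
    scaleLattice ϖ⁻¹ (latt ((P : Matrix (Fin 2) (Fin 2) E) * Matrix.diagonal ![ϖ ^ a, ϖ ^ b])) =
      latt ((P : Matrix (Fin 2) (Fin 2) E) * Matrix.diagonal ![ϖ ^ (a - 1), ϖ ^ (b - 1)]) := by
  have h := scaleLattice_zpow_latt_mul_diagonal hϖ P a b (-1)
  rwa [_root_.zpow_neg_one, ← sub_eq_add_neg, ← sub_eq_add_neg] at h

/-- `latt g ≤ latt g′ ↔ g′⁻¹ g` is integral. [cite: Serre1980Trees, II.1.1] -/
theorem latt_le_latt_iff (g g' : GL (Fin 2) E) :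
    latt (g : Matrix (Fin 2) (Fin 2) E) ≤ latt (g' : Matrix (Fin 2) (Fin 2) E) ↔ IsIntegralMatrix (((g'⁻¹ * g : GL (Fin 2) E)) : Matrix (Fin 2) (Fin 2) E) := by
  have h1 : latt (g : Matrix (Fin 2) (Fin 2) E) = (latt (((g'⁻¹ * g : GL (Fin 2) E)) : Matrix (Fin 2) (Fin 2) E)).map
      ((Matrix.toLin' (g' : Matrix (Fin 2) (Fin 2) E)).restrictScalars 𝒪[E]) := by
    rw [← latt_mul, ← Units.val_mul, mul_inv_cancel_left]
  have h2 : latt (g' : Matrix (Fin 2) (Fin 2) E) = (latt (1 : Matrix (Fin 2) (Fin 2) E)).map ((Matrix.toLin' (g' : Matrix (Fin 2) (Fin 2) E)).restrictScalars 𝒪[E]) := by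
    rw [← latt_mul, Matrix.mul_one]
  have hinj : Function.Injective ((Matrix.toLin' (g' : Matrix (Fin 2) (Fin 2) E)).restrictScalars 𝒪[E]) := by
    intro x y hxy
    have h := congrArg (fun z => ((g'⁻¹ : GL (Fin 2) E) : Matrix (Fin 2) (Fin 2) E) *ᵥ z) hxy
    simpa only [LinearMap.coe_restrictScalars, Matrix.toLin'_apply, Matrix.mulVec_mulVec, ← Units.val_mul, inv_mul_cancel,
      Units.val_one, Matrix.one_mulVec] using h
  rw [h1, h2, Submodule.map_le_map_iff_of_injective hinj, latt, latt, span_range_transpose_le_one_iff]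
  rfl

include hσv in
/-- **(D1) Self-dual lattices are incomparable**: `M ≤ M′`, both self-dual ⇒ `M = M′` (the change of basis is integral with unit determinant).
[cite: Jacobowitz1962, §7] -/
theorem eq_of_le_of_isSelfDualLattice {M M' : Submodule 𝒪[E] (Fin 2 → E)} (hM : IsSelfDualLattice σ H M) (hM' : IsSelfDualLattice σ H M') (hle : M ≤ M') :
    M = M' := by
  obtain ⟨g, rfl, hu⟩ := hM
  obtain ⟨g', rfl, hu'⟩ := hM'
  set t : GL (Fin 2) E := g'⁻¹ * g with ht
  have hti : IsIntegralMatrix (t : Matrix (Fin 2) (Fin 2) E) := (latt_le_latt_iff g g').1 hle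
  have hgt : g = g' * t := by rw [ht, mul_inv_cancel_left]
  have hdet : valuation E (t : Matrix (Fin 2) (Fin 2) E).det = 1 := by
    have h := hu.2
    rw [hgt, formCongr_mul, Matrix.det_mul, Matrix.det_mul, Matrix.det_transpose, ← RingHom.mapMatrix_apply, ← RingHom.map_det, map_mul, map_mul,
      hσv, hu'.2, mul_one] at h
    have hle1 : valuation E (t : Matrix (Fin 2) (Fin 2) E).det ≤ 1 := (Valuation.mem_integer_iff _ _).1 hti.det_mem
    rcases hle1.lt_or_eq with hlt | heq
    · exfalso
      have := mul_lt_one_of_lt_of_le hlt hle1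
      exact absurd h (ne_of_lt this)
    · exact heq
  have htI : t ∈ glInt 2 E := mem_glInt_of_isIntegralMatrix hti hdet
  rw [hgt]
  exact latt_mul_of_mem_glInt g' t htI

include hσv in
/-- **(D2) `ϖ`-modular lattices are incomparable**: `N ≤ N′`, both `ϖ`-modular ⇒ `N = N′`. [cite: Jacobowitz1962, §8] -/
theorem eq_of_le_of_isModularLattice {N N' : Submodule 𝒪[E] (Fin 2 → E)} (hN : IsModularLattice σ ϖ H N) (hN' : IsModularLattice σ ϖ H N') (hle : N ≤ N') :
    N = N' := by
  obtain ⟨g, rfl, hu⟩ := hN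
  obtain ⟨g', rfl, hu'⟩ := hN'
  set t : GL (Fin 2) E := g'⁻¹ * g with ht
  have hti : IsIntegralMatrix (t : Matrix (Fin 2) (Fin 2) E) := (latt_le_latt_iff g g').1 hle
  have hgt : g = g' * t := by rw [ht, mul_inv_cancel_left]
  have hdet : valuation E (t : Matrix (Fin 2) (Fin 2) E).det = 1 := by
    have h := hu.2
    rw [hgt, formCongr_mul, ← Matrix.smul_mul, ← Matrix.mul_smul, Matrix.det_mul, Matrix.det_mul, Matrix.det_transpose, ← RingHom.mapMatrix_apply,
      ← RingHom.map_det, map_mul, map_mul, hσv, hu'.2, mul_one] at h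
    have hle1 : valuation E (t : Matrix (Fin 2) (Fin 2) E).det ≤ 1 := (Valuation.mem_integer_iff _ _).1 hti.det_mem
    rcases hle1.lt_or_eq with hlt | heq
    · exfalso
      have := mul_lt_one_of_lt_of_le hlt hle1
      exact absurd h (ne_of_lt this)
    · exact heq
  have htI : t ∈ glInt 2 E := mem_glInt_of_isIntegralMatrix hti hdet
  rw [hgt]
  exact latt_mul_of_mem_glInt g' t htI

include hϖ in
/-- Depth of a framed lattice with `0 ≤ max(a,b)`, as an integer. [cite: Serre1980Trees, II.1.1] -/
theorem latticeDepth_frame_cast (P : GL (Fin 2) E) (hP : P ∈ glInt 2 E) {a b : ℤ} (h : 0 ≤ max a b) :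
    ((latticeDepth ϖ (latt ((P : Matrix (Fin 2) (Fin 2) E) * Matrix.diagonal ![ϖ ^ a, ϖ ^ b])) : ℕ) : ℤ) = max a b := by
  rw [latticeDepth_latt_mul_diagonal hϖ P hP, Int.toNat_of_nonneg h]

variable [IsDiscreteValuationRing 𝒪[E]]

include hσv hϖ hH in
/-- **(D3)** a SELF-DUAL lattice containing `ϖ^k L₀` is contained in `ϖ^{−k} L₀` (its frame exponents are `±` each other). [cite: Serre1980Trees, II.1.1] -/
theorem le_scaleLattice_of_isSelfDualLattice {M : Submodule 𝒪[E] (Fin 2 → E)} (hM : IsSelfDualLattice σ H M) (k : ℤ)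
    (hk : scaleLattice (ϖ ^ k) (latt (1 : Matrix (Fin 2) (Fin 2) E)) ≤ M) : M ≤ scaleLattice (ϖ ^ (-k)) (latt (1 : Matrix (Fin 2) (Fin 2) E)) := by
  obtain ⟨g, rfl, -⟩ := id hM
  obtain ⟨P, hP, a, b, hfr⟩ := exists_frame hϖ g
  rw [hfr] at hM hk ⊢
  have hab := ((isSelfDualLattice_frame_iff σ hσv hϖ hH P hP a b).1 hM).1
  rw [scaleLattice_zpow_latt_one_le_iff hϖ P hP] at hk
  rw [latt_mul_diagonal_le_scaleLattice_zpow_latt_one_iff hϖ P hP]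
  omega

include hσv hϖ hH in
/-- **(D4)** a `ϖ`-MODULAR lattice containing `ϖ^k L₀` is contained in `ϖ^{1−k} L₀`. [cite: Serre1980Trees, II.1.1] -/
theorem le_scaleLattice_of_isModularLattice {N : Submodule 𝒪[E] (Fin 2 → E)} (hN : IsModularLattice σ ϖ H N) (k : ℤ)
    (hk : scaleLattice (ϖ ^ k) (latt (1 : Matrix (Fin 2) (Fin 2) E)) ≤ N) : N ≤ scaleLattice (ϖ ^ (1 - k)) (latt (1 : Matrix (Fin 2) (Fin 2) E)) := by
  obtain ⟨g, rfl, -⟩ := id hN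
  obtain ⟨P, hP, a, b, hfr⟩ := exists_frame hϖ g
  rw [hfr] at hN hk ⊢
  have hab := ((isModularLattice_frame_iff σ hσv hϖ hH P hP a b).1 hN).1
  rw [scaleLattice_zpow_latt_one_le_iff hϖ P hP] at hk
  rw [latt_mul_diagonal_le_scaleLattice_zpow_latt_one_iff hϖ P hP]
  omega

omit [IsDiscreteValuationRing 𝒪[E]] in
include hσv hϖ hH in
/-- **THE PARENT OF A SELF-DUAL LATTICE** `M ≠ L₀` (framed: `a + b = 0`, depth `k = max(a,b) ≥ 1`): it is the `ϖ`-MODULAR lattice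
`latt (P·diag(ϖ^{max(a,1−k)}, ϖ^{max(b,1−k)}))`, adjacent to `M` (`ϖM ≤ parent ≤ M`), of depth `k`. [cite: Serre1980Trees, II.1.1] [cite: BruhatTits1972, §10] -/
theorem latticeParent_of_isSelfDualLattice (P : GL (Fin 2) E) (hP : P ∈ glInt 2 E) {a b : ℤ}
    (hM : IsSelfDualLattice σ H (latt ((P : Matrix (Fin 2) (Fin 2) E) * Matrix.diagonal ![ϖ ^ a, ϖ ^ b]))) (hk : 1 ≤ max a b) :
    latticeParent σ ϖ H (latt ((P : Matrix (Fin 2) (Fin 2) E) * Matrix.diagonal ![ϖ ^ a, ϖ ^ b])) =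
        latt ((P : Matrix (Fin 2) (Fin 2) E) * Matrix.diagonal ![ϖ ^ max a (1 - max a b), ϖ ^ max b (1 - max a b)]) ∧
      IsModularLattice σ ϖ H (latt ((P : Matrix (Fin 2) (Fin 2) E) * Matrix.diagonal ![ϖ ^ max a (1 - max a b), ϖ ^ max b (1 - max a b)])) ∧
      scaleLattice ϖ (latt ((P : Matrix (Fin 2) (Fin 2) E) * Matrix.diagonal ![ϖ ^ a, ϖ ^ b])) ≤
        latt ((P : Matrix (Fin 2) (Fin 2) E) * Matrix.diagonal ![ϖ ^ max a (1 - max a b), ϖ ^ max b (1 - max a b)]) ∧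
      latt ((P : Matrix (Fin 2) (Fin 2) E) * Matrix.diagonal ![ϖ ^ max a (1 - max a b), ϖ ^ max b (1 - max a b)]) ≤
        latt ((P : Matrix (Fin 2) (Fin 2) E) * Matrix.diagonal ![ϖ ^ a, ϖ ^ b]) ∧
      ((latticeDepth ϖ (latt ((P : Matrix (Fin 2) (Fin 2) E) * Matrix.diagonal ![ϖ ^ max a (1 - max a b), ϖ ^ max b (1 - max a b)])) : ℕ) : ℤ) = max a b := by
  obtain ⟨hab, hent⟩ := (isSelfDualLattice_frame_iff σ hσv hϖ hH P hP a b).1 hM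
  have hG := isUnimodular₂_formCongr_of_mem_glInt σ hσv hH P hP
  refine ⟨?_, ?_, ?_, ?_, ?_⟩
  · rw [latticeParent, if_pos hM, latticeDepth_frame_cast hϖ P hP (by omega), scaleLattice_zpow_latt_one hϖ P hP, latt_mul_diagonal_inf hϖ]
  · rw [isModularLattice_frame_iff σ hσv hϖ hH P hP]
    refine ⟨by omega, fun i j => ?_⟩
    have hij := hent i j
    have hGij : valuation E (formCongr σ P H i j) ≤ 1 := (Valuation.mem_integer_iff _ _).1 (hG.1 i j)
    refine zpow_mul_le_one_of_le hϖ (Or.inl hij) ?_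
    fin_cases i <;> fin_cases j <;> simp only [Matrix.cons_val_zero, Matrix.cons_val_one, Fin.isValue, Fin.mk_one, Fin.zero_eta] <;>
      first
        | exact Or.inl (by omega)
        | exact Or.inr ⟨hGij, by omega⟩
        | (by_cases h0 : 0 ≤ max a (1 - max a b) + max a (1 - max a b) - 1
           · exact Or.inr ⟨hGij, h0⟩
           · exact Or.inl (by omega))
        | (by_cases h0 : 0 ≤ max b (1 - max a b) + max b (1 - max a b) - 1
           · exact Or.inr ⟨hGij, h0⟩
           · exact Or.inl (by omega))
  · rw [scaleLattice_uniformizer_latt_mul_diagonal hϖ, latt_mul_diagonal_le_iff hϖ]; omega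
  · rw [latt_mul_diagonal_le_iff hϖ]; omega
  · rw [latticeDepth_frame_cast hϖ P hP (by omega)]; omega

omit [IsDiscreteValuationRing 𝒪[E]] in
include hσv hϖ hH in
/-- **THE PARENT OF A `ϖ`-MODULAR LATTICE** (framed: `a + b = 1`, depth `k = max(a,b) ≥ 1`): it is the SELF-DUAL lattice
`latt (P·diag(ϖ^{max(a−1,1−k)}, ϖ^{max(b−1,1−k)}))`, adjacent (`ϖ·parent ≤ N ≤ parent`), of depth `k − 1`. [cite: Serre1980Trees, II.1.1] [cite: BruhatTits1972, §10] -/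
theorem latticeParent_of_isModularLattice (P : GL (Fin 2) E) (hP : P ∈ glInt 2 E) {a b : ℤ}
    (hN : IsModularLattice σ ϖ H (latt ((P : Matrix (Fin 2) (Fin 2) E) * Matrix.diagonal ![ϖ ^ a, ϖ ^ b]))) :
    latticeParent σ ϖ H (latt ((P : Matrix (Fin 2) (Fin 2) E) * Matrix.diagonal ![ϖ ^ a, ϖ ^ b])) =
        latt ((P : Matrix (Fin 2) (Fin 2) E) * Matrix.diagonal ![ϖ ^ max (a - 1) (1 - max a b), ϖ ^ max (b - 1) (1 - max a b)]) ∧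
      IsSelfDualLattice σ H (latt ((P : Matrix (Fin 2) (Fin 2) E) * Matrix.diagonal ![ϖ ^ max (a - 1) (1 - max a b), ϖ ^ max (b - 1) (1 - max a b)])) ∧
      scaleLattice ϖ (latt ((P : Matrix (Fin 2) (Fin 2) E) * Matrix.diagonal ![ϖ ^ max (a - 1) (1 - max a b), ϖ ^ max (b - 1) (1 - max a b)])) ≤
        latt ((P : Matrix (Fin 2) (Fin 2) E) * Matrix.diagonal ![ϖ ^ a, ϖ ^ b]) ∧
      latt ((P : Matrix (Fin 2) (Fin 2) E) * Matrix.diagonal ![ϖ ^ a, ϖ ^ b]) ≤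
        latt ((P : Matrix (Fin 2) (Fin 2) E) * Matrix.diagonal ![ϖ ^ max (a - 1) (1 - max a b), ϖ ^ max (b - 1) (1 - max a b)]) ∧
      ((latticeDepth ϖ (latt ((P : Matrix (Fin 2) (Fin 2) E) * Matrix.diagonal ![ϖ ^ max (a - 1) (1 - max a b), ϖ ^ max (b - 1) (1 - max a b)])) : ℕ) : ℤ) =
        max a b - 1 := by
  obtain ⟨hab, hent⟩ := (isModularLattice_frame_iff σ hσv hϖ hH P hP a b).1 hN
  have hG := isUnimodular₂_formCongr_of_mem_glInt σ hσv hH P hP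
  have hnsd : ¬ IsSelfDualLattice σ H (latt ((P : Matrix (Fin 2) (Fin 2) E) * Matrix.diagonal ![ϖ ^ a, ϖ ^ b])) :=
    fun h => not_isModularLattice_of_isSelfDualLattice σ hσv hϖ H h hN
  refine ⟨?_, ?_, ?_, ?_, ?_⟩
  · rw [latticeParent, if_neg hnsd, latticeDepth_frame_cast hϖ P hP (by omega), scaleLattice_zpow_latt_one hϖ P hP,
      scaleLattice_inv_uniformizer_latt_mul_diagonal hϖ, latt_mul_diagonal_inf hϖ]
  · rw [isSelfDualLattice_frame_iff σ hσv hϖ hH P hP]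
    refine ⟨by omega, fun i j => ?_⟩
    have hij := hent i j
    have hGij : valuation E (formCongr σ P H i j) ≤ 1 := (Valuation.mem_integer_iff _ _).1 (hG.1 i j)
    refine zpow_mul_le_one_of_le hϖ (Or.inl hij) ?_
    fin_cases i <;> fin_cases j <;> simp only [Matrix.cons_val_zero, Matrix.cons_val_one, Fin.isValue, Fin.mk_one, Fin.zero_eta] <;>
      first
        | exact Or.inl (by omega)
        | exact Or.inr ⟨hGij, by omega⟩
        | (by_cases h0 : 0 ≤ max (a - 1) (1 - max a b) + max (a - 1) (1 - max a b)
           · exact Or.inr ⟨hGij, h0⟩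
           · exact Or.inl (by omega))
        | (by_cases h0 : 0 ≤ max (b - 1) (1 - max a b) + max (b - 1) (1 - max a b)
           · exact Or.inr ⟨hGij, h0⟩
           · exact Or.inl (by omega))
  · rw [scaleLattice_uniformizer_latt_mul_diagonal hϖ, latt_mul_diagonal_le_iff hϖ]; omega
  · rw [latt_mul_diagonal_le_iff hϖ]; omega
  · rw [latticeDepth_frame_cast hϖ P hP (by omega)]; omega

end Rooted

end Literature.NumberTheory.Automorphic.HermitianLatticeTree

end
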